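import Literature.NumberTheory.Weil1965.ThetaIntegralOrbitFunctionalUnitary
import Literature.MeasureTheory.Group.QuotientAveraging
import Literature.NumberTheory.Automorphic.MirabolicEisensteinSeries
import Literature.NumberTheory.Automorphic.AdelicHeightGLSiegel
import Literature.NumberTheory.Automorphic.AutomorphicFormsGLContinuous
import HarnessLib

/-!
# The theta-side structure letter (Î): `|Λ(Φ)| ≤ ν(𝒢) · sup_{h ∈ Ω} Σ'_{v ≠ 0} |Φ(v L_h)|` through frames `L_h` of bounded height

Topic `NumberTheory/Weil1965`; namespaces `Literature.NumberTheory.Weil1965` (§1, generic) and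
`Literature.NumberTheory.Weil1965.UnitaryDoubling` (§2, the dual pair).  KERNEL MATHEMATICS ONLY: proved theorems, no definition,
no named fact, no `sorry`.  Sequel of ★ `ThetaIntegralOrbitFunctional` ∕ ★ `ThetaIntegralOrbitFunctionalUnitary`; producer of
the theta-type hypotheses `(Ω, L, cI, hI, 𝒴, H₀, hL)` of ★ `SiegelWeilNarrowRayBound.exists_narrowRay_bound` (Weil's proof of
Théorème 4, n° 50: the theta side of `E'' = I□ − κ₀·E` is estimated on a compact fundamental set of `[U(J_V)]` through the frames
`L_h`, whose finite parts stay in a compact set and whose archimedean heights stay bounded):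
* §1 (generic, `Λ(Φ) = ∫_{G/Γ} Σ'_{ξ≠0} Φ(A(g) ξ) dν`): `ratVec_vecMul_actTwistGL` (`v L_g = A(g) v` on rational vectors),
  `exists_isCompact_forall_exists_mk_eq` (a compact set of representatives `Ω`),
  **`enorm_orbitFunctional_le`** — `hI` with `L := actTwistGL F A`, `cI := ν univ`, TOKEN-FOR-TOKEN the binder of ★
  `exists_narrowRay_bound`: `(∀ h ∈ Ω, Σ'_{v ≠ 0} ‖Φ(ratVec v ᵥ* L h)‖ₑ ≤ B) → ‖Λ Φ‖ₑ ≤ ν univ · B`;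
  **`exists_isCompact_sndHom_mem_archHeight_le`** — `h𝒴`, `hL`: on a compact `Ω` the frames `L_h` have finite parts in a compact
  `𝒴 ⊆ GL_m(𝔸_F^∞)` and archimedean height `≤ H₀` (★ `continuous_actTwistGL`, ★ `GLn.continuous_sndHom`, ★ `GLn.continuous_archHeight`);
  `exists_thetaFrameDatum` — the package `∃ Ω 𝒴 H₀, …`;
* §2 (the dual pair, `EI := thetaOrbitFunctional ν`, `L := actTwistGL F (vDiagAct …)`): **`enorm_thetaOrbitFunctional_le`**,
  **`exists_thetaFrameDatum_unitary`**.

## References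
* [Weil1965] A. Weil, *Sur la formule de Siegel dans la théorie des groupes classiques*, Acta Math. 113 (1965): Chap. IV n° 50
  (proof of Théorème 4), pp. 71–73; n° 52.
* [Weil1964] A. Weil, Acta Math. 111 (1964), Chap. III n° 41, Lemme 5 p. 192 (frames of bounded height on compacta).
-/

set_option autoImplicit false

noncomputable section

namespace Literature.NumberTheory.Weil1965

open Literature.NumberTheory.Automorphic Literature.NumberTheory.Weil1964
open NumberField _root_.MeasureTheory Filter _root_.Topology IsDedekindDomain
open scoped Matrix ENNReal NNReal

/-! ### §1 Generic -/

section Generic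

variable (F : Type) [Field F] [NumberField F] {m : ℕ}
variable {G : Type*} [Group G] [TopologicalSpace G] [IsTopologicalGroup G] [LocallyCompactSpace G]
variable (Γ : Subgroup G) [CompactSpace (G ⧸ Γ)] [MeasurableSpace (G ⧸ Γ)] [BorelSpace (G ⧸ Γ)]
variable (ν : Measure (G ⧸ Γ)) [IsFiniteMeasure ν]
variable (A : G →* ((Fin m → AdeleRing (𝓞 F) F) ≃ₗ[AdeleRing (𝓞 F) F] (Fin m → AdeleRing (𝓞 F) F)))
variable (hA : ∀ x : Fin m → AdeleRing (𝓞 F) F, Continuous fun g => A g x)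
variable (hΓ : ∀ γ ∈ Γ, ∀ ξ : Fin m → F, ∃ ξ' : Fin m → F, A γ (ratPt F (Fin m) ξ) = ratPt F (Fin m) ξ')

omit [TopologicalSpace G] [IsTopologicalGroup G] [LocallyCompactSpace G] in
/-- **`v L_g = A(g) v` on rational vectors**: the frame `L_g := actTwistGL F A g` (`= (actMatrix g)ᵀ`, ★ `coe_actTwistGL`) acts on the
principal vector `ratVec v = ratPt v` as the geometric action. [cite: Weil1965, n° 45] -/
theorem ratVec_vecMul_actTwistGL (g : G) (v : Fin m → F) :
    ratVec F v ᵥ* ((actTwistGL F A g : GL (Fin m) (AdeleRing (𝓞 F) F)) : Matrix (Fin m) (Fin m) (AdeleRing (𝓞 F) F)) =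
      A g (ratPt F (Fin m) v) := by
  rw [coe_actTwistGL, Matrix.vecMul_transpose, actMatrix_mulVec]
  rfl

omit [MeasurableSpace (G ⧸ Γ)] [BorelSpace (G ⧸ Γ)] in
/-- **a compact set of representatives** of the compact quotient `G ⧸ Γ` (★ `WeilQuotient.exists_isCompact_image_mk_superset`).
[cite: Weil1964, Chap. III n° 41, Lemme 5 p. 192] -/
theorem exists_isCompact_forall_exists_mk_eq :
    ∃ Ω : Set G, IsCompact Ω ∧ ∀ q : G ⧸ Γ, ∃ g ∈ Ω, (g : G ⧸ Γ) = q := by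
  obtain ⟨Ω, hΩ, hcov⟩ := Literature.MeasureTheory.Group.WeilQuotient.exists_isCompact_image_mk_superset (H := Γ)
    (isCompact_univ : IsCompact (Set.univ : Set (G ⧸ Γ)))
  exact ⟨Ω, hΩ, fun q => by
    obtain ⟨g, hg, hgq⟩ := hcov (Set.mem_univ q)
    exact ⟨g, hg, hgq⟩⟩

include hA in
/-- **(Î) — THE THETA-SIDE BOUND THROUGH FRAMES**: if `Ω ⊆ G` meets every class of `G ⧸ Γ` and
`Σ'_{v ≠ 0} ‖Φ(ratVec v ᵥ* L_h)‖ₑ ≤ B` for all `h ∈ Ω` (`L_h := actTwistGL F A h`), then `‖Λ(Φ)‖ₑ ≤ ν(univ) · B` — the binder `hI` of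
★ `exists_narrowRay_bound` with `cI := ν univ`, token for token. [cite: Weil1965, Chap. IV n° 50, pp. 71–73] -/
theorem enorm_orbitFunctional_le (Ω : Set G) (hΩ : ∀ q : G ⧸ Γ, ∃ g ∈ Ω, (g : G ⧸ Γ) = q) :
    ∀ (Φ : piSchwartzBruhat F (Fin m)) (B : ℝ≥0∞),
      (∀ h ∈ Ω, ∑' v : ↥{v : Fin m → F | v ≠ 0},
        (‖(Φ : (Fin m → AdeleRing (𝓞 F) F) → ℂ) (ratVec F (v : Fin m → F) ᵥ*
          (actTwistGL F A h : Matrix (Fin m) (Fin m) (AdeleRing (𝓞 F) F)))‖ₑ : ℝ≥0∞) ≤ B) →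
      (‖orbitFunctional F Γ ν A hA hΓ Φ‖ₑ : ℝ≥0∞) ≤ ν Set.univ * B := by
  intro Φ B hB
  by_cases hν : ν Set.univ = 0
  · have h0 : ∫ q, orbitSumQuot F Γ A hΓ (Φ : (Fin m → AdeleRing (𝓞 F) F) → ℂ) q ∂ν = 0 := by
      rw [Measure.measure_univ_eq_zero.mp hν, integral_zero_measure]
    rw [orbitFunctional_apply, h0, enorm_zero]
    exact zero_le
  by_cases hBtop : B = ⊤
  · rw [hBtop, ENNReal.mul_top hν]
    exact le_top
  -- `B = b < ∞`: every descended orbit sum is bounded by `b`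
  lift B to ℝ≥0 using hBtop with b
  have hq : ∀ q : G ⧸ Γ, ‖orbitSumQuot F Γ A hΓ (Φ : (Fin m → AdeleRing (𝓞 F) F) → ℂ) q‖ ≤ (b : ℝ) := fun q => by
    obtain ⟨g, hg, hgq⟩ := hΩ q
    rw [← hgq, orbitSumQuot_mk]
    have hs := summable_norm_orbitSum_term A Φ.2 g
    refine (norm_tsum_le_tsum_norm hs).trans ?_
    -- the real sum is the `toReal` of the `ℝ≥0∞` sum of the hypothesis
    have hB' := hB g hg
    simp only [ratVec_vecMul_actTwistGL] at hB'
    have hsum : ENNReal.ofReal (∑' ξ : NonzeroRat F m, ‖(Φ : (Fin m → AdeleRing (𝓞 F) F) → ℂ) (A g (ratPt F (Fin m) (ξ : Fin m → F)))‖) =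
        ∑' ξ : NonzeroRat F m, (‖(Φ : (Fin m → AdeleRing (𝓞 F) F) → ℂ) (A g (ratPt F (Fin m) (ξ : Fin m → F)))‖ₑ : ℝ≥0∞) := by
      rw [ENNReal.ofReal_tsum_of_nonneg (fun _ => norm_nonneg _) hs]
      exact tsum_congr fun _ => ofReal_norm _
    have h2 : ENNReal.ofReal (∑' ξ : NonzeroRat F m, ‖(Φ : (Fin m → AdeleRing (𝓞 F) F) → ℂ) (A g (ratPt F (Fin m) (ξ : Fin m → F)))‖) ≤ (b : ℝ≥0∞) :=
      hsum.trans_le hB'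
    exact (ENNReal.ofReal_le_iff_le_toReal ENNReal.coe_ne_top).1 h2 |>.trans_eq (ENNReal.coe_toReal b)
  have hint := norm_integral_le_of_norm_le_const (μ := ν) (Eventually.of_forall hq)
  rw [orbitFunctional_apply, ← ofReal_norm, mul_comm (ν Set.univ) (b : ℝ≥0∞)]
  refine (ENNReal.ofReal_le_ofReal hint).trans_eq ?_
  rw [ENNReal.ofReal_mul b.coe_nonneg, ENNReal.ofReal_coe_nnreal, ofReal_measureReal]

omit [LocallyCompactSpace G] in
include hA in
/-- **(Î) — THE FRAMES HAVE COMPACT FINITE PARTS AND BOUNDED ARCHIMEDEAN HEIGHT on a compact `Ω`**: the binders `h𝒴`, `hL` of ★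
`exists_narrowRay_bound` for `L := actTwistGL F A` (continuity ★ `continuous_actTwistGL`, ★ `GLn.continuous_sndHom`, ★
`GLn.continuous_archHeight`). [cite: Weil1964, Chap. III n° 41, Lemme 5 p. 192] -/
theorem exists_isCompact_sndHom_mem_archHeight_le {Ω : Set G} (hΩ : IsCompact Ω) :
    ∃ 𝒴 : Set (GL (Fin m) (FiniteAdeleRing (𝓞 F) F)), IsCompact 𝒴 ∧ ∃ H₀ : ℝ, ∀ h ∈ Ω,
      GLn.sndHom m F (actTwistGL F A h) ∈ 𝒴 ∧ (GLn.archHeight m F (actTwistGL F A h) : ℝ) ≤ H₀ := by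
  have hc : Continuous (actTwistGL F A) := continuous_actTwistGL F A hA
  have hK : IsCompact (actTwistGL F A '' Ω) := hΩ.image hc
  obtain ⟨H₀, hH₀⟩ := (hK.image GLn.continuous_archHeight).bddAbove
  refine ⟨GLn.sndHom m F '' (actTwistGL F A '' Ω), hK.image GLn.continuous_sndHom, H₀, fun h hh =>
    ⟨Set.mem_image_of_mem _ (Set.mem_image_of_mem _ hh), ?_⟩⟩
  exact_mod_cast hH₀ (Set.mem_image_of_mem _ (Set.mem_image_of_mem _ hh))

omit [MeasurableSpace (G ⧸ Γ)] [BorelSpace (G ⧸ Γ)] in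
include hA in
/-- **THE (Î) DATUM, PACKAGED**: a compact set of representatives `Ω` of `G ⧸ Γ` together with the compact set `𝒴` of finite
parts and the height bound `H₀` of its frames. [cite: Weil1965, Chap. IV n° 50, pp. 71–73] -/
theorem exists_thetaFrameDatum :
    ∃ Ω : Set G, IsCompact Ω ∧ (∀ q : G ⧸ Γ, ∃ g ∈ Ω, (g : G ⧸ Γ) = q) ∧
      ∃ 𝒴 : Set (GL (Fin m) (FiniteAdeleRing (𝓞 F) F)), IsCompact 𝒴 ∧ ∃ H₀ : ℝ, ∀ h ∈ Ω,
        GLn.sndHom m F (actTwistGL F A h) ∈ 𝒴 ∧ (GLn.archHeight m F (actTwistGL F A h) : ℝ) ≤ H₀ := by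
  obtain ⟨Ω, hΩ, hcov⟩ := exists_isCompact_forall_exists_mk_eq Γ
  exact ⟨Ω, hΩ, hcov, exists_isCompact_sndHom_mem_archHeight_le F A hA hΩ⟩

end Generic

end Literature.NumberTheory.Weil1965

/-! ### §2 The dual pair: `EI := Λ_θ`, `L := actTwistGL F (vDiagAct …)`, `cI := ν univ` -/

namespace Literature.NumberTheory.Weil1965.UnitaryDoubling

open scoped Matrix ENNReal NNReal
open _root_.MeasureTheory NumberField IsDedekindDomain
open Literature.NumberTheory.Weil1964 Literature.NumberTheory.Weil1965 Literature.NumberTheory.Automorphic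
open Literature.NumberTheory.GelbartRogawski1991 Literature.NumberTheory.GelbartRogawski1991.UnitaryDualPair

section DualPair

variable (F E : Type) [Field F] [NumberField F] [Field E] [NumberField E] [Algebra F E] [Algebra.IsQuadraticExtension F E]
  (c : E ≃ₐ[F] E) {δ : E} (hcδ : c δ = -δ) (hδ : δ ≠ 0) {d : F} (hd : δ * δ = algebraMap F E d)
  (N : ℕ) {n : ℕ} (e : Fin N × Fin 1 ≃ Fin n)
  (TV : Matrix (Fin N) (Fin N) F) (hV : TV.IsSymm) (hVd : IsUnit TV.det)
  (TW : Matrix (Fin 1) (Fin 1) F) (hW : TW.IsSymm) (hWd : IsUnit TW.det)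
  [LocallyCompactSpace (UnitaryGroup.adelic F E c N (TV.map (algebraMap F E)))]
  [CompactSpace (UnitaryGroup.adelic F E c N (TV.map (algebraMap F E)) ⧸ (UnitaryGroup.toAdelic F E c N (TV.map (algebraMap F E))).range)]
  [MeasurableSpace (UnitaryGroup.adelic F E c N (TV.map (algebraMap F E)) ⧸ (UnitaryGroup.toAdelic F E c N (TV.map (algebraMap F E))).range)]
  [BorelSpace (UnitaryGroup.adelic F E c N (TV.map (algebraMap F E)) ⧸ (UnitaryGroup.toAdelic F E c N (TV.map (algebraMap F E))).range)]
  (ν : Measure (UnitaryGroup.adelic F E c N (TV.map (algebraMap F E)) ⧸ (UnitaryGroup.toAdelic F E c N (TV.map (algebraMap F E))).range)) [IsFiniteMeasure ν]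

/-- **(Î) FOR THE DUAL PAIR — `hI`** with `EI := thetaOrbitFunctional ν`, `L := actTwistGL F (vDiagAct …)`, `cI := ν univ`: for every
`Ω ⊆ U(J_V)(𝔸)` meeting every class of `[U(J_V)]`, `(∀ h ∈ Ω, Σ'_{v ≠ 0} ‖Ψ(ratVec v ᵥ* L h)‖ₑ ≤ B) → ‖Λ_θ Ψ‖ₑ ≤ ν(univ) · B`.
[cite: Weil1965, Chap. IV n° 50, pp. 71–73; n° 52] -/
theorem enorm_thetaOrbitFunctional_le (Ω : Set (UnitaryGroup.adelic F E c N (TV.map (algebraMap F E))))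
    (hΩ : ∀ q : UnitaryGroup.adelic F E c N (TV.map (algebraMap F E)) ⧸ (UnitaryGroup.toAdelic F E c N (TV.map (algebraMap F E))).range,
      ∃ h ∈ Ω, (h : _ ⧸ (UnitaryGroup.toAdelic F E c N (TV.map (algebraMap F E))).range) = q) :
    ∀ (Ψ : piSchwartzBruhat F (Fin (n + n))) (B : ℝ≥0∞),
      (∀ h ∈ Ω, ∑' v : ↥{v : Fin (n + n) → F | v ≠ 0},
        (‖(Ψ : (Fin (n + n) → AdeleRing (𝓞 F) F) → ℂ) (ratVec F (v : Fin (n + n) → F) ᵥ*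
          (actTwistGL F (vDiagAct F E c hcδ hδ hd N e TV hV hVd TW hW hWd) h :
            Matrix (Fin (n + n)) (Fin (n + n)) (AdeleRing (𝓞 F) F)))‖ₑ : ℝ≥0∞) ≤ B) →
      (‖thetaOrbitFunctional F E c hcδ hδ hd N e TV hV hVd TW hW hWd ν Ψ‖ₑ : ℝ≥0∞) ≤ ν Set.univ * B :=
  enorm_orbitFunctional_le F (UnitaryGroup.toAdelic F E c N (TV.map (algebraMap F E))).range ν
    (vDiagAct F E c hcδ hδ hd N e TV hV hVd TW hW hWd) (continuous_vDiagAct_apply F E c hcδ hδ hd N e TV hV hVd TW hW hWd)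
    (vDiagAct_ratPt_of_mem F E c hcδ hδ hd N e TV hV hVd TW hW hWd) Ω hΩ

omit [MeasurableSpace (UnitaryGroup.adelic F E c N (TV.map (algebraMap F E)) ⧸ (UnitaryGroup.toAdelic F E c N (TV.map (algebraMap F E))).range)]
  [BorelSpace (UnitaryGroup.adelic F E c N (TV.map (algebraMap F E)) ⧸ (UnitaryGroup.toAdelic F E c N (TV.map (algebraMap F E))).range)] in
/-- **(Î) FOR THE DUAL PAIR — THE FRAME DATUM `(Ω, 𝒴, H₀)`**: a compact set of representatives `Ω` of `[U(J_V)]` whose frames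
`L_h = actTwistGL F (vDiagAct …) h` have finite parts in a compact `𝒴` and archimedean height `≤ H₀` (the binders `h𝒴`, `hL`).
[cite: Weil1965, Chap. IV n° 50, pp. 71–73; n° 52] -/
theorem exists_thetaFrameDatum_unitary :
    ∃ Ω : Set (UnitaryGroup.adelic F E c N (TV.map (algebraMap F E))), IsCompact Ω ∧
      (∀ q : UnitaryGroup.adelic F E c N (TV.map (algebraMap F E)) ⧸ (UnitaryGroup.toAdelic F E c N (TV.map (algebraMap F E))).range,
        ∃ h ∈ Ω, (h : _ ⧸ (UnitaryGroup.toAdelic F E c N (TV.map (algebraMap F E))).range) = q) ∧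
      ∃ 𝒴 : Set (GL (Fin (n + n)) (FiniteAdeleRing (𝓞 F) F)), IsCompact 𝒴 ∧ ∃ H₀ : ℝ, ∀ h ∈ Ω,
        GLn.sndHom (n + n) F (actTwistGL F (vDiagAct F E c hcδ hδ hd N e TV hV hVd TW hW hWd) h) ∈ 𝒴 ∧
          (GLn.archHeight (n + n) F (actTwistGL F (vDiagAct F E c hcδ hδ hd N e TV hV hVd TW hW hWd) h) : ℝ) ≤ H₀ :=
  exists_thetaFrameDatum F (UnitaryGroup.toAdelic F E c N (TV.map (algebraMap F E))).range
    (vDiagAct F E c hcδ hδ hd N e TV hV hVd TW hW hWd) (continuous_vDiagAct_apply F E c hcδ hδ hd N e TV hV hVd TW hW hWd)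

end DualPair

end Literature.NumberTheory.Weil1965.UnitaryDoubling
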